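import Mathlib
import Literature.AlgebraicGeometry.Resolution.PointBlowupFlagInvariant
import Literature.AlgebraicGeometry.Resolution.PointBlowupHeightVectorDrops
import Literature.AlgebraicGeometry.Resolution.PointBlowupFlagMaximalShift
import Summits.ResolutionOfSingularities.ResolutionOfSingularities.Theorems.WeightedInvariantLocalWeightedDropInsepCleaning
import Summits.ResolutionOfSingularities.ResolutionOfSingularities.Theorems.WeightedInvariantLocalWeightedDropInsepNewtonMeasures
import Summits.ResolutionOfSingularities.ResolutionOfSingularities.Theorems.WeightedInvariantLocalWeightedDropInsepNewtonVMove
import Summits.ResolutionOfSingularities.ResolutionOfSingularities.Theorems.WeightedInvariantLocalWeightedDropInsepNewtonVHeight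
import Summits.ResolutionOfSingularities.ResolutionOfSingularities.Theorems.WeightedInvariantLocalWeightedDropInsepNewtonSlope
import Summits.ResolutionOfSingularities.ResolutionOfSingularities.Theorems.WeightedInvariantLocalWeightedDropInsepNewtonShear

/-!
# `WeightedInvariant.LocalWeightedDrop`, line `hasse-ridge-face-selection`: the ORIENTATION SWAP `x₀ ↔ x₁` and the Newton measures,
# the cleaning, the shears and the lift's charts (unit M6a plumbing of stub-3's M6 design memo)

Crux item stmt-ResolutionOfSingularities-8899 `LocalWeightedDrop` (route `ResolutionOfSingularities/WeightedInvariant`),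
serving the door `WeightedConstruction` stmt-ResolutionOfSingularities-0571.  [OURS · L1 W4.3, chain w43, stub worker 3
(gen 3): M6-DESIGN §6 plumbing for the S2iM calibration track (CHAIN D12); folklore bookkeeping, NOT a statement of any manuscript.]

The lift `insepWon_of_stateRank(_sel)` renumbers the letters at every blow-up: after a (T)/(H) point the rigid (exceptional) letter is
slot `0` and the free letter slot `1`, while the class-level layer (`…InsepNewtonShear`, `…TMove`, `…SlopeBound`, `…ShearComm`) is
written once, for free `= 0`, rigid `= 1`.  The swap `swap H := rename (Equiv.swap 0 1) H` converts: `coeff_swap`, `swap_swap`,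
`order_swap`, `ordVarPS_swap_zero/one`, `degAlongPS_swap`, `heightPS_swap`, `fiberMinPS_swap`, `fiberSlopePS_swap`, `slopePS_swap`
(measure in orientation `(rig, free) = (0, 1)` = measure of the swap in orientation `(1, 0)`), `cleanSeries_swap`, `swap_subst_shear'`
(the shear of slot `1` by `φ(x₀)` becomes the shear of slot `0` by `φ(x₁)`), `subst_pointChart_zero_eq_swap` (the lift's chart in the live
slot `0` at `c` is the chart in the live slot `1` at `c ∘ swap` of the swapped series — target letters unchanged).
-/

set_option linter.dupNamespace false -- mandated namespace of this single-conjunct summit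

namespace Summit.ResolutionOfSingularities.ResolutionOfSingularities.Theorems

namespace InsepNewton

open MvPowerSeries
open Literature.AlgebraicGeometry.Resolution
open Literature.AlgebraicGeometry.Resolution.HauserPerlega2024 (ordAlong cleanSeries)
open Literature.AlgebraicGeometry.Resolution.HauserWagner2014 (ordVarPS degAlongPS heightPS fiberMinPS fiberSlopePS slopePS)

variable {K : Type} [Field K]

/-! ### Coefficients of the swapped series -/

/-- The swap of a two-letter exponent. -/
theorem mapDomain_swap_pair (a b : ℕ) :
    Finsupp.mapDomain (Equiv.swap (0 : Fin 2) 1) (Finsupp.single 0 a + Finsupp.single 1 b) =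
      Finsupp.single 0 b + Finsupp.single 1 a := by
  rw [Finsupp.mapDomain_add, Finsupp.mapDomain_single, Finsupp.mapDomain_single, Equiv.swap_apply_left,
    Equiv.swap_apply_right, add_comm]

/-- **COEFFICIENTS OF THE SWAP**: `[x₀^a x₁^b] swap H = [x₀^b x₁^a] H`. -/
theorem coeff_swap (H : MvPowerSeries (Fin 2) K) (a b : ℕ) :
    coeff (Finsupp.single 0 a + Finsupp.single 1 b) (rename (Equiv.swap (0 : Fin 2) 1) H) =
      coeff (Finsupp.single 0 b + Finsupp.single 1 a) H := by
  have h := coeff_embDomain_rename (R := K) (Equiv.swap (0 : Fin 2) 1).toEmbedding H (Finsupp.single 0 b + Finsupp.single 1 a)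
  have hmd : Finsupp.embDomain (Equiv.swap (0 : Fin 2) 1).toEmbedding (Finsupp.single 0 b + Finsupp.single 1 a) =
      Finsupp.single 0 a + Finsupp.single 1 b := by
    rw [Finsupp.embDomain_eq_mapDomain]
    exact mapDomain_swap_pair b a
  rw [hmd] at h
  convert h using 2
  rw [rename_eq_subst, rename_eq_subst]
  rfl

/-- … for a general exponent `d`: `[d] swap H = [x₀^{d₁} x₁^{d₀}] H`. -/
theorem coeff_swap' (H : MvPowerSeries (Fin 2) K) (d : Fin 2 →₀ ℕ) :
    coeff d (rename (Equiv.swap (0 : Fin 2) 1) H) = coeff (Finsupp.single 0 (d 1) + Finsupp.single 1 (d 0)) H := by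
  conv_lhs => rw [← coeff_single_add_single_eq d]
  exact coeff_swap H (d 0) (d 1)

/-- The swap is an involution. -/
theorem swap_swap (H : MvPowerSeries (Fin 2) K) :
    rename (Equiv.swap (0 : Fin 2) 1) (rename (Equiv.swap (0 : Fin 2) 1) H) = H := by
  ext d
  rw [coeff_swap', coeff_swap, coeff_single_add_single_eq]

/-- A support point of `H`, swapped, is a support point of `swap H`. -/
theorem coeff_swap_ne_zero {H : MvPowerSeries (Fin 2) K} {d : Fin 2 →₀ ℕ} (hd : coeff d H ≠ 0) :
    coeff (Finsupp.single 0 (d 1) + Finsupp.single 1 (d 0)) (rename (Equiv.swap (0 : Fin 2) 1) H) ≠ 0 := by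
  rw [coeff_swap, coeff_single_add_single_eq]; exact hd

/-- The swap of a non-zero series is non-zero. -/
theorem swap_ne_zero {H : MvPowerSeries (Fin 2) K} (hH : H ≠ 0) : rename (Equiv.swap (0 : Fin 2) 1) H ≠ 0 := by
  intro h
  apply hH
  rw [← swap_swap H, h, map_zero]

/-- **THE ORDER IS KEPT** by the swap. -/
theorem order_swap (H : MvPowerSeries (Fin 2) K) : (rename (Equiv.swap (0 : Fin 2) 1) H).order = H.order := by
  have key : ∀ G : MvPowerSeries (Fin 2) K, G.order ≤ (rename (Equiv.swap (0 : Fin 2) 1) G).order := by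
    intro G
    refine le_order fun d hd => ?_
    rw [coeff_swap']
    apply coeff_of_lt_order
    rw [degree_pair]
    rw [← coeff_single_add_single_eq d, degree_pair] at hd
    rwa [add_comm]
  refine le_antisymm ?_ (key H)
  have h := key (rename (Equiv.swap (0 : Fin 2) 1) H)
  rwa [swap_swap] at h

/-! ### The Newton measures of the swapped series -/

/-- `ord_{x₀}(swap H) = ord_{x₁}(H)`. -/
theorem ordVarPS_swap_zero {H : MvPowerSeries (Fin 2) K} (hH : H ≠ 0) :
    ordVarPS (rename (Equiv.swap (0 : Fin 2) 1) H) 0 = ordVarPS H 1 := by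
  refine le_antisymm ?_ ?_
  · obtain ⟨d, hd, hd1⟩ := exists_coeff_apply_eq_ordVarPS 1 hH
    have h := ordVarPS_le 0 (coeff_swap_ne_zero hd)
    rwa [pair_apply_zero, hd1] at h
  · obtain ⟨e, he, he0⟩ := exists_coeff_apply_eq_ordVarPS 0 (swap_ne_zero hH)
    rw [coeff_swap'] at he
    have h := ordVarPS_le 1 he
    rwa [pair_apply_one, he0] at h

/-- `ord_{x₁}(swap H) = ord_{x₀}(H)`. -/
theorem ordVarPS_swap_one {H : MvPowerSeries (Fin 2) K} (hH : H ≠ 0) :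
    ordVarPS (rename (Equiv.swap (0 : Fin 2) 1) H) 1 = ordVarPS H 0 := by
  have h := ordVarPS_swap_zero (swap_ne_zero hH)
  rw [swap_swap] at h
  exact h.symm

/-- **THE HIGHEST VERTEX**: `degAlong (swap H) 1 0 = degAlong H 0 1` (orientation `(rig, free) = (0, 1)` read on the swap as `(1, 0)`). -/
theorem degAlongPS_swap {H : MvPowerSeries (Fin 2) K} (hH : H ≠ 0) :
    degAlongPS (rename (Equiv.swap (0 : Fin 2) 1) H) 1 0 = degAlongPS H 0 1 := by
  have hβ := ordVarPS_swap_one hH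
  refine le_antisymm ?_ ?_
  · obtain ⟨d, hd, hd0, hd1⟩ := exists_vertex hH 0 1
    have h := degAlongPS_le (rig := 1) (free := 0) (coeff_swap_ne_zero hd) (by rw [pair_apply_one, hβ, hd0])
    rwa [pair_apply_zero, hd1] at h
  · obtain ⟨e, he, he1, he0⟩ := exists_vertex (swap_ne_zero hH) 1 0
    rw [coeff_swap'] at he
    have h := degAlongPS_le (rig := 0) (free := 1) he (by rw [pair_apply_zero, he1, hβ])
    rwa [pair_apply_one, he0] at h

/-- **THE HEIGHT**: `height (swap H) 1 0 = height H 0 1`. -/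
theorem heightPS_swap {H : MvPowerSeries (Fin 2) K} (hH : H ≠ 0) :
    heightPS (rename (Equiv.swap (0 : Fin 2) 1) H) 1 0 = heightPS H 0 1 := by
  rw [heightPS, heightPS, degAlongPS_swap hH, ordVarPS_swap_zero hH]

/-- **THE FIBRES**: `fiberMin (swap H) 1 0 a = fiberMin H 0 1 a`. -/
theorem fiberMinPS_swap (H : MvPowerSeries (Fin 2) K) (a : ℕ) :
    fiberMinPS (rename (Equiv.swap (0 : Fin 2) 1) H) 1 0 a = fiberMinPS H 0 1 a := by
  refine le_antisymm ?_ ?_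
  · refine le_fiberMinPS_iff.mpr fun d hd hda => ?_
    have h := fiberMinPS_le (rig := 1) (free := 0) (coeff_swap_ne_zero hd) (by rw [pair_apply_zero, hda])
    rwa [pair_apply_one] at h
  · refine le_fiberMinPS_iff.mpr fun e he hea => ?_
    rw [coeff_swap'] at he
    have h := fiberMinPS_le (rig := 0) (free := 1) he (by rw [pair_apply_one, hea])
    rwa [pair_apply_zero] at h

/-- **THE FIBRE CONTRIBUTIONS TO THE SLOPE** agree. -/
theorem fiberSlopePS_swap {H : MvPowerSeries (Fin 2) K} (hH : H ≠ 0) (a : ℕ) :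
    fiberSlopePS (rename (Equiv.swap (0 : Fin 2) 1) H) 1 0 a = fiberSlopePS H 0 1 a := by
  unfold fiberSlopePS
  rw [fiberMinPS_swap, degAlongPS_swap hH, ordVarPS_swap_one hH]

/-- **THE SLOPE**: `slope (swap H) 1 0 = slope H 0 1`. -/
theorem slopePS_swap {H : MvPowerSeries (Fin 2) K} (hH : H ≠ 0) :
    slopePS (rename (Equiv.swap (0 : Fin 2) 1) H) 1 0 = slopePS H 0 1 := by
  rw [slopePS_def, slopePS_def, degAlongPS_swap hH]
  exact Finset.inf_congr rfl fun a _ => fiberSlopePS_swap hH a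

/-! ### Cleaning, shears and the lift's charts under the swap -/

/-- **CLEANING COMMUTES WITH THE SWAP**. -/
theorem cleanSeries_swap (q : ℕ) (H : MvPowerSeries (Fin 2) K) :
    cleanSeries q (rename (Equiv.swap (0 : Fin 2) 1) H) = rename (Equiv.swap (0 : Fin 2) 1) (cleanSeries q H) := by
  classical
  ext d
  rw [InsepCleaning.coeff_cleanSeries, coeff_swap', coeff_swap', InsepCleaning.coeff_cleanSeries]
  have hiff : (∀ i : Fin 2, q ∣ d i) ↔ ∀ i : Fin 2, q ∣ (Finsupp.single (0 : Fin 2) (d 1) + Finsupp.single 1 (d 0) : Fin 2 →₀ ℕ) i := by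
    constructor
    · intro h i
      rcases (by fin_cases i <;> simp : i = 0 ∨ i = 1) with rfl | rfl
      · rw [pair_apply_zero]; exact h 1
      · rw [pair_apply_one]; exact h 0
    · intro h i
      rcases (by fin_cases i <;> simp : i = 0 ∨ i = 1) with rfl | rfl
      · have := h 1; rwa [pair_apply_one] at this
      · have := h 0; rwa [pair_apply_zero] at this
  by_cases hall : ∀ i : Fin 2, q ∣ d i
  · rw [if_pos hall, if_pos (hiff.mp hall)]
  · rw [if_neg hall, if_neg (fun h => hall (hiff.mpr h))]

/-- The swap as a substitution of variables (`rename_eq_subst`). -/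
theorem swap_eq_subst (H : MvPowerSeries (Fin 2) K) :
    rename (Equiv.swap (0 : Fin 2) 1) H = subst (fun s : Fin 2 => (X (Equiv.swap (0 : Fin 2) 1 s) : MvPowerSeries (Fin 2) K)) H := by
  rw [rename_eq_subst]; rfl

/-- **THE SHEAR OF SLOT `1` BY `φ(x₀)`, SWAPPED, IS THE SHEAR OF SLOT `0` BY `φ(x₁)`**:
`swap (θ′_φ^* A) = θ_φ^* (swap A)`. -/
theorem swap_subst_shear' {φ : PowerSeries K} (hφ : PowerSeries.constantCoeff φ = 0) (A : MvPowerSeries (Fin 2) K) :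
    rename (Equiv.swap (0 : Fin 2) 1) (subst (fun l : Fin 2 => if l = 1 then
        (X 1 : MvPowerSeries (Fin 2) K) + PowerSeries.subst (X 0 : MvPowerSeries (Fin 2) K) φ else X l) A) =
      subst (fun l : Fin 2 => if l = 0 then
        (X 0 : MvPowerSeries (Fin 2) K) + PowerSeries.subst (X 1 : MvPowerSeries (Fin 2) K) φ else X l)
        (rename (Equiv.swap (0 : Fin 2) 1) A) := by
  have hθ' := HauserPerlega2024.hasSubst_shift (0 : Fin 2) 1 φ hφ
  have hθ := hasSubst_shear (K := K) hφ
  have hσ : HasSubst (fun s : Fin 2 => (X (Equiv.swap (0 : Fin 2) 1 s) : MvPowerSeries (Fin 2) K)) := HasSubst.X_comp _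
  rw [swap_eq_subst, swap_eq_subst, subst_comp_subst_apply hθ' hσ, subst_comp_subst_apply hσ hθ]
  congr 1
  funext l
  rcases (by fin_cases l <;> simp : l = 0 ∨ l = 1) with rfl | rfl
  · rw [if_neg (show (0 : Fin 2) ≠ 1 by decide), subst_X hσ, subst_X hθ, Equiv.swap_apply_left,
      if_neg (show (1 : Fin 2) ≠ 0 by decide)]
  · rw [if_pos rfl, subst_X hθ, Equiv.swap_apply_right, if_pos rfl, subst_add hσ, subst_X hσ, Equiv.swap_apply_right]
    congr 1
    have e1 : PowerSeries.subst (X 0 : MvPowerSeries (Fin 2) K) φ =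
        MvPowerSeries.subst (fun _ : Unit => (X 0 : MvPowerSeries (Fin 2) K)) φ := PowerSeries.subst_def _ _
    have e2 : PowerSeries.subst (X 1 : MvPowerSeries (Fin 2) K) φ =
        MvPowerSeries.subst (fun _ : Unit => (X 1 : MvPowerSeries (Fin 2) K)) φ := PowerSeries.subst_def _ _
    rw [e1, e2, subst_comp_subst_apply (PowerSeries.HasSubst.const (PowerSeries.HasSubst.X 0)) hσ]
    congr 1
    funext u
    rw [subst_X hσ, Equiv.swap_apply_left]

/-- **THE LIFT'S CHART IN THE LIVE SLOT `0` IS THE CHART IN THE LIVE SLOT `1` OF THE SWAP** (target letters unchanged: `X₀` stays the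
exceptional letter): `π_{0,c}^* A = π_{1, c ∘ swap}^* (swap A)`. -/
theorem subst_pointChart_zero_eq_swap (c : Fin 2 → K) (A : MvPowerSeries (Fin 2) K) :
    subst (fun l : Fin 2 => if l = 0 then C (c 0) * X 0 else X 0 * (C (c l) + (X 1 : MvPowerSeries (Fin 2) K))) A =
      subst (fun l : Fin 2 => if l = 1 then C ((c ∘ Equiv.swap (0 : Fin 2) 1) 1) * X 0 else
        X 0 * (C ((c ∘ Equiv.swap (0 : Fin 2) 1) l) + (X 1 : MvPowerSeries (Fin 2) K))) (rename (Equiv.swap (0 : Fin 2) 1) A) := by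
  have hσ : HasSubst (fun s : Fin 2 => (X (Equiv.swap (0 : Fin 2) 1 s) : MvPowerSeries (Fin 2) K)) := HasSubst.X_comp _
  have h1 := InsepDoublePoint.hasSubst_pi (k := K) 1 (c ∘ Equiv.swap (0 : Fin 2) 1)
  rw [swap_eq_subst, subst_comp_subst_apply hσ h1]
  congr 1
  funext l
  rcases (by fin_cases l <;> simp : l = 0 ∨ l = 1) with rfl | rfl
  · rw [if_pos rfl, subst_X h1, Equiv.swap_apply_left, if_pos rfl, Function.comp_apply, Equiv.swap_apply_right]
  · rw [if_neg (show (1 : Fin 2) ≠ 0 by decide), subst_X h1, Equiv.swap_apply_right, if_neg (show (0 : Fin 2) ≠ 1 by decide),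
      Function.comp_apply, Equiv.swap_apply_left]

/-- The swap fixes `X₀² · A` up to swapping `A`… no: the TARGET of a chart is never swapped; but a factorisation `π^* A = X₀² A′` of the
swapped chart is read through `subst_pointChart_zero_eq_swap` verbatim.  For the class layer one also needs: the swap of a product with
`X₀²` — `swap (X₀² · A) = X₁² · swap A`. -/
theorem swap_X_zero_sq_mul (A : MvPowerSeries (Fin 2) K) :
    rename (Equiv.swap (0 : Fin 2) 1) (X 0 ^ 2 * A) = X 1 ^ 2 * rename (Equiv.swap (0 : Fin 2) 1) A := by
  rw [map_mul, map_pow, rename_X, Equiv.swap_apply_left]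

end InsepNewton

end Summit.ResolutionOfSingularities.ResolutionOfSingularities.Theorems
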